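import Summits.Ventures.PercRepro.S2LPCore
import Summits.Ventures.PercRepro.RankLevelSetCircuitCount

/-!
# PercRepro — THE COLOOP-FREE DEPENDENT SETS AT BOUNDED NULLITY: `#{coloop-free dependent s-sets} ≤ C(d + s − 1, s)`
(p2, gen 30; the level-5 coloop/closure LP, SUBCLAIM-S2 feeder)

Night-1's circuit count (`ncard_circuits_le_choose`: a matroid of nullity `d` has at most `C(d + k − 1, k)` circuits
with `k` elements) extends verbatim to the COLOOP-FREE DEPENDENT sets: a set `T` with `T` dependent and no `x ∈ T`
with `ρ(T ∖ x) + 1 = ρ(T)` (the circuits are the nullity-`1` ones). Deletion / contraction induction on `|E|`: for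
an element `e` of such a set (never a coloop) the sets avoiding `e` are those of `M ＼ {e}` (nullity `d − 1`); the sets
through `e` inject by `T ↦ T ∖ {e}` into those of `M ／ {e}` (nullity `d`, `e` a non-loop) or, when `e` is a loop,
into those of `M ＼ {e}` together with `{e}`; Pascal's rule adds up. The consequences for the
classes `nuSets` are in `S2LPClasses`. Nothing is claimed about any cell.

* `cfree`, `mem_cfree`, `cfree_finite`, `mem_closure_of_notMem_coloopsOf`, `not_isColoop_of_mem_cfree`,
  **`ncard_cfree_le_choose`**, `ncard_cfree_le_choose_of_encard`.
Axioms: standard.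
-/

open scoped Matroid

namespace PercRepro

namespace S2LP

open Set Finset

variable {α : Type}

/-- The coloop-free dependent sets of `s` elements. -/
def cfree (M : Matroid α) (s : ℕ) : Set (Set α) :=
  {T : Set α | T ⊆ M.E ∧ T.ncard = s ∧ M.Dep T ∧ coloopsOf M T = ∅}

/-- Membership in `cfree`. -/
theorem mem_cfree {M : Matroid α} {s : ℕ} {T : Set α} :
    T ∈ cfree M s ↔ T ⊆ M.E ∧ T.ncard = s ∧ M.Dep T ∧ coloopsOf M T = ∅ := Iff.rfl

/-- `cfree` is finite. -/
theorem cfree_finite (M : Matroid α) [M.Finite] (s : ℕ) : (cfree M s).Finite :=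
  M.ground_finite.finite_subsets.subset (fun _ h => h.1)

/-- A non-coloop `x` of a finite set `T` lies in the closure of `T ∖ x`. -/
theorem mem_closure_of_notMem_coloopsOf {M : Matroid α} {T : Set α} (hT : T ⊆ M.E) {x : α}
    (hx : x ∈ T) (hnot : x ∉ coloopsOf M T) : x ∈ M.closure (T \ {x}) := by
  by_contra hcl
  apply hnot
  refine ⟨hx, ?_⟩
  have h := Matroid.eRk_insert_eq_add_one (M := M) (X := T \ {x}) (e := x) ⟨hT hx, hcl⟩
  rw [insert_sdiff_singleton, insert_eq_of_mem hx] at h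
  rw [h]

/-- An element of a coloop-free set is not a coloop of the matroid. -/
theorem not_isColoop_of_mem_cfree {M : Matroid α} [M.Finite] {s : ℕ} {T : Set α} (hT : T ∈ cfree M s) {e : α}
    (he : e ∈ T) : ¬ M.IsColoop e := by
  intro hcol
  have hmem : e ∈ M.closure (T \ {e}) :=
    mem_closure_of_notMem_coloopsOf hT.1 he (by rw [hT.2.2.2]; exact notMem_empty e)
  have := (Matroid.isColoop_iff_notMem_closure_compl (hT.1 he)).1 hcol
  exact this (M.closure_subset_closure (sdiff_subset_sdiff_left hT.1) hmem)

/-- **THE COLOOP-FREE COUNT AT BOUNDED NULLITY**: a finite matroid of nullity `d` (`M✶.eRank = d`) has at most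
`C(d + s − 1, s)` coloop-free dependent sets with `s ≥ 1` elements. -/
theorem ncard_cfree_le_choose (M : Matroid α) [M.Finite] {d : ℕ} (hd : M✶.eRank = (d : ℕ∞)) (s : ℕ) (hs : 1 ≤ s) :
    (cfree M s).ncard ≤ (d + s - 1).choose s := by
  suffices H : ∀ n : ℕ, ∀ (M : Matroid α) [M.Finite], M.E.ncard = n → ∀ (d s : ℕ), 1 ≤ s →
      M✶.eRank = (d : ℕ∞) → (cfree M s).ncard ≤ (d + s - 1).choose s from H _ M rfl d s hs hd
  intro n
  induction n using Nat.strong_induction_on with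
  | _ n ih =>
  intro M _ hn d s hs hd
  classical
  obtain ⟨k, rfl⟩ : ∃ k, s = k + 1 := ⟨s - 1, by omega⟩
  set S := cfree M (k + 1) with hS
  have hSfin : S.Finite := cfree_finite M (k + 1)
  by_cases hSe : S = ∅
  · rw [hSe, ncard_empty]; exact Nat.zero_le _
  obtain ⟨T₀, hT₀⟩ := nonempty_iff_ne_empty.2 hSe
  have hT₀ne : T₀.Nonempty := by
    rw [← ncard_pos (M.ground_finite.subset hT₀.1), hT₀.2.1]; omega
  obtain ⟨e, heT₀⟩ := hT₀ne
  have heE : e ∈ M.E := hT₀.1 heT₀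
  -- `e` is not a coloop: `M ＼ {e}` has nullity `d − 1`
  have hne : ¬ M.IsColoop e := not_isColoop_of_mem_cfree hT₀ heT₀
  have hdel := Matroid.dual_eRank_delete_singleton_add_one heE hne
  rw [hd] at hdel
  have hfin' : (M ＼ {e})✶.eRank ≠ ⊤ := by
    intro h
    rw [h] at hdel
    exact absurd hdel (by simp)
  obtain ⟨d', hd'⟩ := ENat.ne_top_iff_exists.1 hfin'
  have hdd' : d = d' + 1 := by
    rw [← hd'] at hdel
    exact_mod_cast hdel.symm
  have hdelE : (M ＼ {e}).E.ncard < n := by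
    rw [Matroid.delete_ground, ← hn, ← ncard_sdiff_singleton_add_one heE M.ground_finite]
    omega
  -- split by whether `e` lies in the set
  set S₁ := {T ∈ S | e ∈ T} with hS₁
  set S₂ := {T ∈ S | e ∉ T} with hS₂
  have hsplit : S ⊆ S₁ ∪ S₂ := by
    intro T hT
    by_cases h : e ∈ T
    · exact Or.inl ⟨hT, h⟩
    · exact Or.inr ⟨hT, h⟩
  have hS₁fin : S₁.Finite := hSfin.subset (fun _ hT => hT.1)
  have hS₂fin : S₂.Finite := hSfin.subset (fun _ hT => hT.1)
  -- ranks in `M ＼ {e}` of sets avoiding `e` are the ranks in `M`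
  have hcolDel : ∀ T ⊆ M.E \ {e}, coloopsOf (M ＼ {e}) T = coloopsOf M T := by
    intro T hT
    ext x
    simp only [coloopsOf, mem_setOf_eq]
    constructor
    · rintro ⟨hx, h⟩
      refine ⟨hx, ?_⟩
      rwa [delete_singleton_eRk_eq (sdiff_subset.trans hT), delete_singleton_eRk_eq hT] at h
    · rintro ⟨hx, h⟩
      refine ⟨hx, ?_⟩
      rwa [delete_singleton_eRk_eq (sdiff_subset.trans hT), delete_singleton_eRk_eq hT]
  -- the sets avoiding `e` are coloop-free dependent sets of `M ＼ {e}`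
  have h2 : S₂.ncard ≤ (d' + (k + 1) - 1).choose (k + 1) := by
    have hsub : S₂ ⊆ cfree (M ＼ {e}) (k + 1) := by
      rintro T ⟨hT, heT⟩
      have hTE : T ⊆ M.E \ {e} := fun y hy => (Set.mem_sdiff y).2 ⟨hT.1 hy, fun hye => heT (by rw [mem_singleton_iff] at hye; rw [← hye]; exact hy)⟩
      refine ⟨by rw [Matroid.delete_ground]; exact hTE, hT.2.1, ?_, ?_⟩
      · exact Matroid.delete_dep_iff.2 ⟨hT.2.2.1, disjoint_singleton_right.2 heT⟩
      · rw [hcolDel T hTE]; exact hT.2.2.2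
    calc S₂.ncard ≤ (cfree (M ＼ {e}) (k + 1)).ncard := ncard_le_ncard hsub (cfree_finite _ _)
      _ ≤ (d' + (k + 1) - 1).choose (k + 1) := ih _ hdelE (M ＼ {e}) rfl d' (k + 1) (by omega) hd'.symm
  -- the sets through `e`
  have h1 : S₁.ncard ≤ (d' + (k + 1) - 1).choose k := by
    by_cases hloop : M.IsLoop e
    · -- `e` a loop: `T ↦ T ∖ {e}` lands in `cfree (M ＼ {e}) k`, or `T = {e}` when `k = 0`
      have hmaps : ∀ T ∈ S₁, T \ {e} ∈ cfree (M ＼ {e}) k ∪ {∅} := by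
        rintro T ⟨hT, heT⟩
        have hTfin : T.Finite := M.ground_finite.subset hT.1
        have hTE : T \ {e} ⊆ M.E \ {e} := sdiff_subset_sdiff_left hT.1
        have hcard : (T \ {e}).ncard = k := by
          have := ncard_sdiff_singleton_add_one heT hTfin
          rw [hT.2.1] at this
          omega
        by_cases hk : T \ {e} = ∅
        · exact Or.inr (by rw [mem_singleton_iff]; exact hk)
        left
        refine ⟨by rw [Matroid.delete_ground]; exact hTE, hcard, ?_, ?_⟩
        · -- `T ∖ {e}` is dependent: otherwise its elements would be coloops of `T`
          rw [Matroid.delete_dep_iff]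
          refine ⟨?_, disjoint_singleton_right.2 (fun h => h.2 rfl)⟩
          by_contra hind
          have hind' : M.Indep (T \ {e}) := by
            rcases (M.indep_or_dep (show T \ {e} ⊆ M.E from sdiff_subset.trans hT.1)) with h | h
            · exact h
            · exact absurd h hind
          obtain ⟨x, hx⟩ := nonempty_iff_ne_empty.2 hk
          have hxT : x ∈ T := hx.1
          have hxe : x ≠ e := fun h => hx.2 (by rw [h]; rfl)
          -- `x` is a coloop of `T`
          have hcol : x ∈ coloopsOf M T := by
            refine ⟨hxT, ?_⟩
            have hTx : T \ {x} = insert e ((T \ {e}) \ {x}) := by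
              ext y
              simp only [Set.mem_sdiff, Set.mem_singleton_iff, Set.mem_insert_iff]
              constructor
              · rintro ⟨hy, hyx⟩
                by_cases hye : y = e
                · exact Or.inl hye
                · exact Or.inr ⟨⟨hy, hye⟩, hyx⟩
              · rintro (rfl | ⟨⟨hy, -⟩, hyx⟩)
                · exact ⟨heT, Ne.symm hxe⟩
                · exact ⟨hy, hyx⟩
            have hT' : T = insert e (T \ {e}) := by rw [insert_sdiff_singleton, insert_eq_of_mem heT]
            have hecl1 : e ∈ M.closure ((T \ {e}) \ {x}) := hloop.mem_closure _
            have hecl2 : e ∈ M.closure (T \ {e}) := hloop.mem_closure _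
            rw [hTx, eRk_insert_eq_of_mem_closure (sdiff_subset.trans (sdiff_subset.trans hT.1)) hecl1]
            conv_rhs => rw [hT', eRk_insert_eq_of_mem_closure (sdiff_subset.trans hT.1) hecl2]
            rw [hind'.eRk_eq_encard, (hind'.subset sdiff_subset).eRk_eq_encard,
              ← hTfin.sdiff.cast_ncard_eq, ← (hTfin.sdiff.sdiff).cast_ncard_eq,
              ncard_sdiff_singleton_of_mem (show x ∈ T \ {e} from ⟨hxT, hxe⟩)]
            have hpos : 1 ≤ (T \ {e}).ncard := (ncard_pos hTfin.sdiff).2 (nonempty_iff_ne_empty.2 hk)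
            norm_cast
            omega
          rw [hT.2.2.2] at hcol
          exact notMem_empty x hcol
        · rw [hcolDel _ hTE]
          -- a coloop of `T ∖ {e}` would be a coloop of `T`
          ext x
          simp only [mem_empty_iff_false, iff_false]
          rintro ⟨hx, hrk⟩
          have hxe : x ≠ e := fun h => hx.2 (by rw [h]; rfl)
          have hcol : x ∈ coloopsOf M T := by
            refine ⟨hx.1, ?_⟩
            have hTx : T \ {x} = insert e ((T \ {e}) \ {x}) := by
              ext y
              simp only [Set.mem_sdiff, Set.mem_singleton_iff, Set.mem_insert_iff]
              constructor
              · rintro ⟨hy, hyx⟩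
                by_cases hye : y = e
                · exact Or.inl hye
                · exact Or.inr ⟨⟨hy, hye⟩, hyx⟩
              · rintro (rfl | ⟨⟨hy, -⟩, hyx⟩)
                · exact ⟨heT, Ne.symm hxe⟩
                · exact ⟨hy, hyx⟩
            have hT' : T = insert e (T \ {e}) := by rw [insert_sdiff_singleton, insert_eq_of_mem heT]
            rw [hTx, eRk_insert_eq_of_mem_closure (sdiff_subset.trans (sdiff_subset.trans hT.1)) (hloop.mem_closure _)]
            conv_rhs => rw [hT', eRk_insert_eq_of_mem_closure (sdiff_subset.trans hT.1) (hloop.mem_closure _)]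
            exact hrk
          rw [hT.2.2.2] at hcol
          exact notMem_empty x hcol
      have hinj : InjOn (fun T : Set α => T \ {e}) S₁ := by
        rintro T hT T' hT' h
        have e1 : T = insert e (T \ {e}) := by rw [insert_sdiff_singleton, insert_eq_of_mem hT.2]
        have e2 : T' = insert e (T' \ {e}) := by rw [insert_sdiff_singleton, insert_eq_of_mem hT'.2]
        rw [e1, e2]
        simp only at h
        rw [h]
      have hfinU : (cfree (M ＼ {e}) k ∪ {∅}).Finite := (cfree_finite _ _).union (finite_singleton _)
      calc S₁.ncard ≤ (cfree (M ＼ {e}) k ∪ {∅}).ncard := ncard_le_ncard_of_injOn _ hmaps hinj hfinU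
        _ ≤ (cfree (M ＼ {e}) k).ncard + ({∅} : Set (Set α)).ncard := ncard_union_le _ _
        _ ≤ (d' + (k + 1) - 1).choose k := by
            rw [ncard_singleton]
            rcases k with _ | k
            · -- `k = 0`: `cfree (M ＼ {e}) 0 = ∅`
              have h0 : cfree (M ＼ {e}) 0 = ∅ := by
                ext T
                simp only [mem_empty_iff_false, iff_false]
                rintro ⟨-, hT0, hTdep, -⟩
                have : T = ∅ := ncard_eq_zero (M.ground_finite.subset (by
                  have := hTdep.subset_ground; rw [Matroid.delete_ground] at this
                  exact this.trans sdiff_subset)) |>.1 hT0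
                rw [this] at hTdep
                exact hTdep.not_indep (M ＼ {e}).empty_indep
              rw [h0, ncard_empty]; simp
            · have := ih _ hdelE (M ＼ {e}) rfl d' (k + 1) (by omega) hd'.symm
              have hmono : (d' + (k + 1) - 1).choose (k + 1) + 1 ≤ (d' + (k + 1 + 1) - 1).choose (k + 1) := by
                have hP := Nat.choose_succ_succ' (d' + (k + 1) - 1) k
                have hpos : 1 ≤ (d' + (k + 1) - 1).choose k := Nat.choose_pos (by omega)
                rw [show d' + (k + 1 + 1) - 1 = (d' + (k + 1) - 1) + 1 by omega]
                omega
              omega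
    · -- `e` a non-loop: `T ↦ T ∖ {e}` injects into `cfree (M ／ {e}) k`
      have heI : M.Indep {e} := by
        rw [Matroid.indep_singleton, ← Matroid.not_isLoop_iff heE]; exact hloop
      have hconE : (M ／ {e}).E.ncard < n := by
        rw [Matroid.contract_ground, ← hn, ← ncard_sdiff_singleton_add_one heE M.ground_finite]
        omega
      have hdc : (M ／ {e})✶.eRank = (d : ℕ∞) := by rw [Matroid.dual_eRank_contract_singleton heI, hd]
      have hmaps : ∀ T ∈ S₁, T \ {e} ∈ cfree (M ／ {e}) k := by
        rintro T ⟨hT, heT⟩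
        have hTfin : T.Finite := M.ground_finite.subset hT.1
        have hTE : T \ {e} ⊆ M.E \ {e} := sdiff_subset_sdiff_left hT.1
        have hcard : (T \ {e}).ncard = k := by
          have := ncard_sdiff_singleton_add_one heT hTfin
          rw [hT.2.1] at this
          omega
        have hT' : T = insert e (T \ {e}) := by rw [insert_sdiff_singleton, insert_eq_of_mem heT]
        -- the contracted rank: `ρ'(T ∖ e) + 1 = ρ(T)`
        have hrk : (M ／ {e}).eRk (T \ {e}) + 1 = M.eRk T := by
          rw [contract_singleton_eRk_add_one heI hTE, ← hT']
        refine ⟨by rw [Matroid.contract_ground]; exact hTE, hcard, ?_, ?_⟩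
        · -- dependent in `M ／ {e}`
          rw [← Matroid.eRk_lt_encard_iff_dep_of_finite hTfin.sdiff (by rw [Matroid.contract_ground]; exact hTE)]
          have hdepT := (Matroid.eRk_lt_encard_iff_dep_of_finite hTfin hT.1).2 hT.2.2.1
          rw [← hTfin.cast_ncard_eq, hT.2.1] at hdepT
          rw [← hTfin.sdiff.cast_ncard_eq, hcard]
          have hfinr : (M ／ {e}).eRk (T \ {e}) ≠ ⊤ := by
            intro h; rw [h] at hrk; exact absurd hrk.symm (by
              rw [top_add]; exact ne_top_of_lt hdepT)
          obtain ⟨a, ha⟩ := ENat.ne_top_iff_exists.1 hfinr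
          rw [← ha] at hrk ⊢
          rw [← hrk] at hdepT
          have : a + 1 < k + 1 := by exact_mod_cast hdepT
          exact_mod_cast (show a < k by omega)
        · -- coloop-free in `M ／ {e}`
          ext x
          simp only [mem_empty_iff_false, iff_false]
          rintro ⟨hx, hrkx⟩
          have hxe : x ≠ e := fun h => hx.2 (by rw [h]; rfl)
          have hTx : T \ {x} = insert e ((T \ {e}) \ {x}) := by
            ext y
            simp only [Set.mem_sdiff, Set.mem_singleton_iff, Set.mem_insert_iff]
            constructor
            · rintro ⟨hy, hyx⟩
              by_cases hye : y = e
              · exact Or.inl hye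
              · exact Or.inr ⟨⟨hy, hye⟩, hyx⟩
            · rintro (rfl | ⟨⟨hy, -⟩, hyx⟩)
              · exact ⟨heT, Ne.symm hxe⟩
              · exact ⟨hy, hyx⟩
          have hrk2 : (M ／ {e}).eRk ((T \ {e}) \ {x}) + 1 = M.eRk (T \ {x}) := by
            rw [contract_singleton_eRk_add_one heI (sdiff_subset.trans hTE), ← hTx]
          have hcol : x ∈ coloopsOf M T := by
            refine ⟨hx.1, ?_⟩
            rw [← hrk2, ← hrk, ← hrkx]
          rw [hT.2.2.2] at hcol
          exact notMem_empty x hcol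
      have hinj : InjOn (fun T : Set α => T \ {e}) S₁ := by
        rintro T hT T' hT' h
        have e1 : T = insert e (T \ {e}) := by rw [insert_sdiff_singleton, insert_eq_of_mem hT.2]
        have e2 : T' = insert e (T' \ {e}) := by rw [insert_sdiff_singleton, insert_eq_of_mem hT'.2]
        rw [e1, e2]
        simp only at h
        rw [h]
      rcases k with _ | k
      · -- `k = 0`: no coloop-free dependent `0`-set, so `S₁ = ∅`
        have h0 : cfree (M ／ {e}) 0 = ∅ := by
          ext T
          simp only [mem_empty_iff_false, iff_false]
          rintro ⟨-, hT0, hTdep, -⟩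
          have : T = ∅ := ncard_eq_zero (M.ground_finite.subset (by
            have := hTdep.subset_ground; rw [Matroid.contract_ground] at this
            exact this.trans sdiff_subset)) |>.1 hT0
          rw [this] at hTdep
          exact hTdep.not_indep (M ／ {e}).empty_indep
        calc S₁.ncard ≤ (cfree (M ／ {e}) 0).ncard := ncard_le_ncard_of_injOn _ hmaps hinj (cfree_finite _ _)
          _ = 0 := by rw [h0, ncard_empty]
          _ ≤ _ := Nat.zero_le _
      · calc S₁.ncard ≤ (cfree (M ／ {e}) (k + 1)).ncard := ncard_le_ncard_of_injOn _ hmaps hinj (cfree_finite _ _)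
          _ ≤ (d + (k + 1) - 1).choose (k + 1) := ih _ hconE (M ／ {e}) rfl d (k + 1) (by omega) hdc
          _ = (d' + (k + 1 + 1) - 1).choose (k + 1) := by rw [hdd']; congr 1; omega
  -- Pascal
  calc S.ncard ≤ (S₁ ∪ S₂).ncard := ncard_le_ncard hsplit (hS₁fin.union hS₂fin)
    _ ≤ S₁.ncard + S₂.ncard := ncard_union_le _ _
    _ ≤ (d' + (k + 1) - 1).choose k + (d' + (k + 1) - 1).choose (k + 1) := add_le_add h1 h2
    _ = (d' + (k + 1) - 1 + 1).choose (k + 1) := (Nat.choose_succ_succ' _ k).symm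
    _ = (d + (k + 1) - 1).choose (k + 1) := by rw [hdd']; congr 1; omega

/-- The count in the `|E| = r(M) + d` form. -/
theorem ncard_cfree_le_choose_of_encard (M : Matroid α) [M.Finite] {d : ℕ} (hd : M.E.encard = M.eRank + d) (s : ℕ)
    (hs : 1 ≤ s) : (cfree M s).ncard ≤ (d + s - 1).choose s := by
  apply ncard_cfree_le_choose M _ s hs
  have h := Matroid.eRank_add_eRank_dual M
  rw [hd] at h
  exact WithTop.add_left_cancel (Matroid.eRank_ne_top_of_finite M) h

end S2LP

end PercRepro
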